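import Summits.CriticalPhenomena.Ising3DConformalLimit.Theses.FKParityRobustness
import Summits.CriticalPhenomena.Ising3DConformalLimit.Theorems.FKParityRobustnessStrandsJoinBound
import Summits.CriticalPhenomena.Ising3DConformalLimit.Theorems.FKParityRobustnessLatticeBoundFromStrands
import Summits.CriticalPhenomena.Ising3DConformalLimit.Theorems.FKParityRobustnessFarMergingGivesU4

/-!
# `JoinForcesU4` — the bridge crux of route `FKParityRobustness` (item `stmt-CriticalPhenomena-14627`)

Sub-problem `Ising3DConformalLimit`, route `FKParityRobustness`, crux (rank 6, BRIDGE)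
`JoinForcesU4 : IndependentStrandsJoin → NonGaussianLimit` (the latter inlined verbatim): if two
INDEPENDENT critical sourced loop-O(1) configurations in the box `Λ_N ⊂ ℤ³`, with sources `{a₀,a₁}` and
`{a₂,a₃}` at the dilated tetrahedron `A_l`, join `a₀` to `a₂` with `ℓ⊗ℓ`-probability `≥ c` uniformly in
`l ≥ 1`, then every non-degenerate pointwise scaling limit `S` of the critical correlators on `ℤ³` has a
non-trivial connected four-point function (`HasNontrivialU4 S`).

**Proof** (the composition `joinForcesU4_of` of the planner's Sketch / `crux_of_supports` of the
disprover's `Disproof.lean`, over the three supports already landed in the tree):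

* `strandsJoinBound_proof` (item 14647, `Theorems/FKParityRobustnessStrandsJoinBound.lean`): on every
  finite graph `U₄^free(a)·(Z⁰_t)² ≤ −2·Σ_{F₁,F₂} t^{|F₁|+|F₂|} 1[a₀ ↔ a₂ in F₁ ∪ F₂]` — Aizenman's
  double-current identity dressed by the odd-part law `law(odd n^S) = ℓ^S`;
* `latticeBoundFromStrands_proof` (item 14648, `Theorems/FKParityRobustnessLatticeBoundFromStrands.lean`):
  `IndependentStrandsJoin →` [that bound] `→ ∃ c > 0, ∀ l ≥ 1, U₄^crit(l·A) ≤ −c·⟨σσ⟩⟨σσ⟩` (box → critical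
  state through `criticalCorr_wellDefined_holds`);
* `farMergingGivesU4_proof` (item 4471, `Theorems/FKParityRobustnessFarMergingGivesU4.lean`): far merging
  along infinitely many dilations of a fixed injective shape forces `HasNontrivialU4` for every
  non-degenerate pointwise scaling limit.

The tetrahedral shape is injective (`tetra_injective`) and "for all `l ≥ 1`" gives "frequently in `L`"
with `L := max L₀ 1`. No named facts are assumed: the theorem is unconditional.

## References

* M. Aizenman, *Geometric analysis of φ⁴ fields and Ising models*, Comm. Math. Phys. 86 (1982),
  Prop. 5.3 [AizenmanCMP1982].
* M. Aizenman, H. Duminil-Copin, *Marginal triviality of the scaling limits of critical 4D Ising and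
  φ⁴₄ models*, Ann. of Math. 194 (2021), eq. (3.11) [AizenmanDuminilCopinAnnals2021].
* M. Aizenman, H. Duminil-Copin, V. Sidoravicius, Comm. Math. Phys. 334 (2015) (continuity at `β_c`)
  [AizenmanDuminilCopinSidoraviciusCMP2015].
-/

namespace Summit.CriticalPhenomena.Ising3DConformalLimit.FKParityRobustnessJoinForcesU4

open Literature.Probability.LatticeModels
open Summit.CriticalPhenomena.Ising3DConformalLimit.Theses.FKParityRobustness
open Summit.CriticalPhenomena.Ising3DConformalLimit.FKParityRobustnessStrandsJoinBound
open Summit.CriticalPhenomena.Ising3DConformalLimit.FKParityRobustnessLatticeBoundFromStrands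
open Summit.CriticalPhenomena.Ising3DConformalLimit.FKParityRobustnessFarMergingGivesU4

/-- **Item `stmt-CriticalPhenomena-14627` — the crux `JoinForcesU4` holds** (unconditionally):
`IndependentStrandsJoin →` every non-degenerate pointwise scaling limit of the critical Ising
correlators on `ℤ³` has `U₄ ≢ 0`. Composition of the landed supports `strandsJoinBound_proof` (14647),
`latticeBoundFromStrands_proof` (14648) and `farMergingGivesU4_proof` (4471) at the tetrahedral shape
`A = {(−1,−1,−1),(1,1,−1),(1,−1,1),(−1,1,1)}` (injective, `tetra_injective`), taking the dilation
`L := max L₀ 1 ≥ 1` for "frequently in `L`". Axioms: propext, Classical.choice, Quot.sound.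
[cite: AizenmanCMP1982, Prop. 5.3] -/
theorem joinForcesU4_proof : JoinForcesU4 := by
  unfold JoinForcesU4
  intro hK1
  obtain ⟨c, hc, hl⟩ := latticeBoundFromStrands_proof hK1 strandsJoinBound_proof
  exact farMergingGivesU4_proof ⟨c, hc, ![![-1, -1, -1], ![1, 1, -1], ![1, -1, 1], ![-1, 1, 1]],
    tetra_injective, fun L₀ => ⟨max L₀ 1, le_max_left _ _, hl (max L₀ 1) (le_max_right _ _)⟩⟩

end Summit.CriticalPhenomena.Ising3DConformalLimit.FKParityRobustnessJoinForcesU4
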